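import Mathlib
import Literature.Analysis.ODE.SchrodingerODE
import Literature.Analysis.ODE.InverseSquareRecessiveVolterra
import HarnessLib

/-!
# Particular solutions of `e'' = P e + r` with power-weighted bounds (variation of parameters)

Analysis/ODE support file (everything proved, no definitions). Let `U, V` be global solutions of
`y'' = P y` with Wronskian `U V' − U' V ≡ 1` and the recessive/dominant bounds of order `n` beyond
`B ≥ 1` (`|U| ≤ c_U z⁻ⁿ`, `|U'| ≤ c_U' z⁻ⁿ⁻¹`, `|V| ≤ 6zⁿ⁺¹`, `|V'| ≤ 5zⁿ`, as produced by
`InverseSquareRecessive/Dominant.lean`), and let `r` be continuous with `|r z| ≤ R₀ z^κ` for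
`z ≥ B`,
where `−n − 2 < κ < n − 1`. Then

  `e(z) = −U(z) ∫_B^z V r − V(z) ∫_z^∞ U r`

satisfies `e' = −U'∫_B^z V r − V'∫_z^∞ U r`, `e'' = P e + r` on `(B,∞)`, and
`|e| ≤ C R₀ z^{κ+2}`, `|e'| ≤ C' R₀ z^{κ+1}` for `z > B` with constants depending only on
`n, κ, c_U, c_U'` (`inverseSquare_particular`). This is the inductive step of the downward
construction of the true non-radiative `t`-polynomial solutions (`a_i = b_i + e_i`,
`r_i = ` chain residual) of the far-side channel estimate of `FixedModeChannels` (route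
PhotonSphereChannels, stmt-FinalStateConjecture-10048). Classical (Hartman, *ODE*, Ch. IV §8,
Ch. XI §9).
-/

noncomputable section

namespace Literature.Analysis.ODE

open MeasureTheory Set Filter Topology intervalIntegral Real

variable {P U V r : ℝ → ℝ} {B cU cU' R₀ κ : ℝ} {n : ℕ}

/-- **Variation of parameters with power weights.** See the module docstring.
[cite: Hartman2002, Ch. XI §9] -/
theorem inverseSquare_particular (hU : IsSchrodingerSol P U)
    (hV : IsSchrodingerSol P V) (hW : ∀ z, U z * deriv V z - deriv U z * V z = 1) (hB : 1 ≤ B)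
    (hcU : 0 ≤ cU) (hcU' : 0 ≤ cU')
    (hUb : ∀ z, B ≤ z → |U z| ≤ cU * z ^ (-(n : ℝ)))
    (hU'b : ∀ z, B ≤ z → |deriv U z| ≤ cU' * z ^ (-(n : ℝ) - 1))
    (hVb : ∀ z, B ≤ z → |V z| ≤ 6 * z ^ ((n : ℝ) + 1))
    (hV'b : ∀ z, B ≤ z → |deriv V z| ≤ 5 * z ^ (n : ℝ))
    (hr : Continuous r) (hR₀ : 0 ≤ R₀) (hκ1 : κ < n - 1) (hκ2 : -(n : ℝ) - 2 < κ)
    (hrb : ∀ z, B ≤ z → |r z| ≤ R₀ * z ^ κ) :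
    (∀ z, B < z →
      HasDerivAt (fun z => -U z * (∫ s in B..z, V s * r s) - V z * ∫ s in Ioi z, U s * r s)
        (-deriv U z * (∫ s in B..z, V s * r s) - deriv V z * ∫ s in Ioi z, U s * r s) z ∧
      HasDerivAt
        (fun z => -deriv U z * (∫ s in B..z, V s * r s) - deriv V z * ∫ s in Ioi z, U s * r s)
        (P z * (-U z * (∫ s in B..z, V s * r s) - V z * ∫ s in Ioi z, U s * r s) + r z) z) ∧
    (∀ z, B ≤ z →
      |(-U z * (∫ s in B..z, V s * r s) - V z * ∫ s in Ioi z, U s * r s)|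
        ≤ (6 * cU * (1 / (n - 1 - κ) + 1 / (κ + n + 2))) * R₀ * z ^ (κ + 2) ∧
      |(-deriv U z * (∫ s in B..z, V s * r s) - deriv V z * ∫ s in Ioi z, U s * r s)|
        ≤ (6 * cU' / (κ + n + 2) + 5 * cU / (n - 1 - κ)) * R₀ * z ^ (κ + 1)) := by
  have hB0 : 0 < B := by linarith
  have hd1 : 0 < n - 1 - κ := by linarith
  have hd2 : 0 < κ + n + 2 := by linarith
  -- integrability of `U r` on `Ioi B` and the tail bound
  have hUrc : Continuous fun s => U s * r s := hU.continuous.mul hr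
  have hVrc : Continuous fun s => V s * r s := hV.continuous.mul hr
  have hUr_bd : ∀ s, B ≤ s → |U s * r s| ≤ cU * R₀ * s ^ (κ - n) := by
    intro s hs
    have hs0 : 0 < s := by linarith
    rw [abs_mul]
    calc |U s| * |r s| ≤ (cU * s ^ (-(n : ℝ))) * (R₀ * s ^ κ) :=
          mul_le_mul (hUb s hs) (hrb s hs) (abs_nonneg _) (by positivity)
      _ = cU * R₀ * s ^ (κ - n) := by
          rw [show κ - n = -(n : ℝ) + κ by ring, rpow_add hs0 (-(n : ℝ)) κ]; ring
  have hpow_i : IntegrableOn (fun s : ℝ => s ^ (κ - n)) (Ioi B) :=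
    integrableOn_Ioi_rpow_of_lt (by linarith) hB0
  have hUri : IntegrableOn (fun s => U s * r s) (Ioi B) :=
    Integrable.mono' (hpow_i.const_mul (cU * R₀)) hUrc.aestronglyMeasurable
      ((ae_restrict_iff' measurableSet_Ioi).2 (ae_of_all _ fun s hs => by
        rw [Real.norm_eq_abs]; exact hUr_bd s (le_of_lt hs)))
  have htail : ∀ z, B ≤ z →
      |∫ s in Ioi z, U s * r s| ≤ cU * R₀ / (n - 1 - κ) * z ^ (κ - n + 1) := by
    intro z hz
    have hz0 : 0 < z := by linarith
    have hpz : IntegrableOn (fun s : ℝ => s ^ (κ - n)) (Ioi z) :=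
      integrableOn_Ioi_rpow_of_lt (by linarith) hz0
    calc |∫ s in Ioi z, U s * r s| ≤ ∫ s in Ioi z, |U s * r s| := abs_integral_le_integral_abs
      _ ≤ ∫ s in Ioi z, cU * R₀ * s ^ (κ - n) :=
          setIntegral_mono_on (hUri.mono_set (Ioi_subset_Ioi hz)).abs (hpz.const_mul _)
            measurableSet_Ioi fun s hs => hUr_bd s (hz.trans (le_of_lt hs))
      _ = cU * R₀ * (-z ^ (κ - n + 1) / (κ - n + 1)) := by
          rw [MeasureTheory.integral_const_mul, integral_Ioi_rpow_of_lt (by linarith) hz0]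
      _ = cU * R₀ / (n - 1 - κ) * z ^ (κ - n + 1) := by
          have : κ - n + 1 ≠ 0 := by linarith
          field_simp
          ring
  -- the interval integral of `V r` and its bound
  have hVr_bd : ∀ s, B ≤ s → |V s * r s| ≤ 6 * R₀ * s ^ (κ + n + 1) := by
    intro s hs
    have hs0 : 0 < s := by linarith
    rw [abs_mul]
    calc |V s| * |r s| ≤ (6 * s ^ ((n : ℝ) + 1)) * (R₀ * s ^ κ) :=
          mul_le_mul (hVb s hs) (hrb s hs) (abs_nonneg _) (by positivity)
      _ = 6 * R₀ * s ^ (κ + n + 1) := by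
          rw [show κ + n + 1 = ((n : ℝ) + 1) + κ by ring, rpow_add hs0 ((n : ℝ) + 1) κ]; ring
  have hhead : ∀ z, B ≤ z → |∫ s in B..z, V s * r s| ≤ 6 * R₀ / (κ + n + 2) * z ^ (κ + n + 2) := by
    intro z hz
    have hz0 : 0 < z := by linarith
    have hcont : ContinuousOn (fun s : ℝ => 6 * R₀ * s ^ (κ + n + 1)) (Icc B z) :=
      continuousOn_const.mul (continuousOn_id.rpow_const fun s hs => Or.inl (by
        have : B ≤ s := hs.1; exact ne_of_gt (show (0:ℝ) < s by linarith)))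
    calc |∫ s in B..z, V s * r s| ≤ ∫ s in B..z, |V s * r s| :=
          intervalIntegral.abs_integral_le_integral_abs hz
      _ ≤ ∫ s in B..z, 6 * R₀ * s ^ (κ + n + 1) :=
          intervalIntegral.integral_mono_on hz ((hVrc.abs).intervalIntegrable _ _)
            (hcont.intervalIntegrable_of_Icc hz) fun s hs => hVr_bd s hs.1
      _ = 6 * R₀ * ((z ^ (κ + n + 2) - B ^ (κ + n + 2)) / (κ + n + 2)) := by
          rw [intervalIntegral.integral_const_mul, integral_rpow (Or.inl (by linarith))]
          ring_nf
      _ ≤ 6 * R₀ / (κ + n + 2) * z ^ (κ + n + 2) := by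
          have hBp : 0 ≤ B ^ (κ + n + 2) := rpow_nonneg hB0.le _
          have h1 : (z ^ (κ + n + 2) - B ^ (κ + n + 2)) / (κ + n + 2)
              ≤ z ^ (κ + n + 2) / (κ + n + 2) :=
            div_le_div_of_nonneg_right (by linarith) hd2.le
          calc 6 * R₀ * ((z ^ (κ + n + 2) - B ^ (κ + n + 2)) / (κ + n + 2))
              ≤ 6 * R₀ * (z ^ (κ + n + 2) / (κ + n + 2)) :=
                mul_le_mul_of_nonneg_left h1 (by positivity)
            _ = 6 * R₀ / (κ + n + 2) * z ^ (κ + n + 2) := by ring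
  -- derivatives of the two integrals on `(B, ∞)`
  have hIVd : ∀ z, B < z → HasDerivAt (fun z => ∫ s in B..z, V s * r s) (V z * r z) z := fun z _ =>
    intervalIntegral.integral_hasDerivAt_right (hVrc.intervalIntegrable _ _)
      (hVrc.stronglyMeasurableAtFilter _ _) hVrc.continuousAt
  have hIUd : ∀ z, B < z → HasDerivAt (fun z => ∫ s in Ioi z, U s * r s) (-(U z * r z)) z :=
    fun z hz => hasDerivAt_setIntegral_Ioi_tail hUrc hUri hz
  refine ⟨fun z hz => ⟨?_, ?_⟩, fun z hz => ⟨?_, ?_⟩⟩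
  · have h := (((hU.hasDerivAt z).neg.mul (hIVd z hz))).sub ((hV.hasDerivAt z).mul (hIUd z hz))
    refine h.congr_deriv ?_
    simp only [Pi.neg_apply]
    ring
  · have h := (((hU.hasDerivAt_deriv z).neg.mul (hIVd z hz))).sub
      ((hV.hasDerivAt_deriv z).mul (hIUd z hz))
    refine h.congr_deriv ?_
    simp only [Pi.neg_apply]
    have hWz := hW z
    linear_combination (r z) * hWz
  · have hz0 : 0 < z := by linarith
    have e1 : |U z * ∫ s in B..z, V s * r s| ≤ 6 * cU * R₀ / (κ + n + 2) * z ^ (κ + 2) := by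
      rw [abs_mul]
      calc |U z| * |∫ s in B..z, V s * r s|
          ≤ (cU * z ^ (-(n : ℝ))) * (6 * R₀ / (κ + n + 2) * z ^ (κ + n + 2)) :=
            mul_le_mul (hUb z hz) (hhead z hz) (abs_nonneg _) (by positivity)
        _ = 6 * cU * R₀ / (κ + n + 2) * (z ^ (-(n : ℝ)) * z ^ (κ + n + 2)) := by ring
        _ = 6 * cU * R₀ / (κ + n + 2) * z ^ (κ + 2) := by
            rw [← rpow_add hz0]; ring_nf
    have e2 : |V z * ∫ s in Ioi z, U s * r s| ≤ 6 * cU * R₀ / (n - 1 - κ) * z ^ (κ + 2) := by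
      rw [abs_mul]
      calc |V z| * |∫ s in Ioi z, U s * r s|
          ≤ (6 * z ^ ((n : ℝ) + 1)) * (cU * R₀ / (n - 1 - κ) * z ^ (κ - n + 1)) :=
            mul_le_mul (hVb z hz) (htail z hz) (abs_nonneg _) (by positivity)
        _ = 6 * cU * R₀ / (n - 1 - κ) * (z ^ ((n : ℝ) + 1) * z ^ (κ - n + 1)) := by ring
        _ = 6 * cU * R₀ / (n - 1 - κ) * z ^ (κ + 2) := by
            rw [← rpow_add hz0]; ring_nf
    calc |(-U z * (∫ s in B..z, V s * r s) - V z * ∫ s in Ioi z, U s * r s)|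
        ≤ |U z * ∫ s in B..z, V s * r s| + |V z * ∫ s in Ioi z, U s * r s| := by
          rw [show -U z * (∫ s in B..z, V s * r s) - V z * ∫ s in Ioi z, U s * r s
            = -(U z * (∫ s in B..z, V s * r s) + V z * ∫ s in Ioi z, U s * r s) by ring, abs_neg]
          exact abs_add_le _ _
      _ ≤ 6 * cU * R₀ / (κ + n + 2) * z ^ (κ + 2) + 6 * cU * R₀ / (n - 1 - κ) * z ^ (κ + 2) :=
          add_le_add e1 e2
      _ = (6 * cU * (1 / (n - 1 - κ) + 1 / (κ + n + 2))) * R₀ * z ^ (κ + 2) := by ring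
  · have hz0 : 0 < z := by linarith
    have e1 : |deriv U z * ∫ s in B..z, V s * r s| ≤ 6 * cU' * R₀ / (κ + n + 2) * z ^ (κ + 1) := by
      rw [abs_mul]
      calc |deriv U z| * |∫ s in B..z, V s * r s|
          ≤ (cU' * z ^ (-(n : ℝ) - 1)) * (6 * R₀ / (κ + n + 2) * z ^ (κ + n + 2)) :=
            mul_le_mul (hU'b z hz) (hhead z hz) (abs_nonneg _) (by positivity)
        _ = 6 * cU' * R₀ / (κ + n + 2) * (z ^ (-(n : ℝ) - 1) * z ^ (κ + n + 2)) := by ring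
        _ = 6 * cU' * R₀ / (κ + n + 2) * z ^ (κ + 1) := by
            rw [← rpow_add hz0]; ring_nf
    have e2 : |deriv V z * ∫ s in Ioi z, U s * r s| ≤ 5 * cU * R₀ / (n - 1 - κ) * z ^ (κ + 1) := by
      rw [abs_mul]
      calc |deriv V z| * |∫ s in Ioi z, U s * r s|
          ≤ (5 * z ^ (n : ℝ)) * (cU * R₀ / (n - 1 - κ) * z ^ (κ - n + 1)) :=
            mul_le_mul (hV'b z hz) (htail z hz) (abs_nonneg _) (by positivity)
        _ = 5 * cU * R₀ / (n - 1 - κ) * (z ^ (n : ℝ) * z ^ (κ - n + 1)) := by ring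
        _ = 5 * cU * R₀ / (n - 1 - κ) * z ^ (κ + 1) := by
            rw [← rpow_add hz0]; ring_nf
    calc |(-deriv U z * (∫ s in B..z, V s * r s) - deriv V z * ∫ s in Ioi z, U s * r s)|
        ≤ |deriv U z * ∫ s in B..z, V s * r s| + |deriv V z * ∫ s in Ioi z, U s * r s| := by
          rw [show -deriv U z * (∫ s in B..z, V s * r s) - deriv V z * ∫ s in Ioi z, U s * r s
            = -(deriv U z * (∫ s in B..z, V s * r s) + deriv V z * ∫ s in Ioi z, U s * r s) by ring,
            abs_neg]
          exact abs_add_le _ _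
      _ ≤ 6 * cU' * R₀ / (κ + n + 2) * z ^ (κ + 1) + 5 * cU * R₀ / (n - 1 - κ) * z ^ (κ + 1) :=
          add_le_add e1 e2
      _ = (6 * cU' / (κ + n + 2) + 5 * cU / (n - 1 - κ)) * R₀ * z ^ (κ + 1) := by ring

end Literature.Analysis.ODE
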